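import Mathlib
import Literature.MathematicalPhysics.QuantumFieldTheory.Balaban1983to89.B14Sect1Sets
import Literature.MathematicalPhysics.QuantumFieldTheory.Balaban1983to89.MatrixLog

/-!
# `Balaban1983to89.B14Eq316` — T. Bałaban, *Convergent renormalization expansions for lattice gauge theories*,
# Commun. Math. Phys. **119** (1988) 243–285 [Balaban1988Convergent]: (3.16) p. 268 (the small/large FLUCTUATION-field
# decomposition of unity of the k+1-st step, PROVED), (3.21) p. 269 (the combined characteristic function, DEFINED) and
# (3.22) p. 269 (the function 𝐇^{(k)}, DEFINED, with `exp i𝐇^{(k)} = V^{(k)}(V^{(k)}_{Λᶜ_{k+1}∩Λ_k})⁻¹` PROVED)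

statement-level skeleton of published theorems with citation tags; proofs where landed; nothing here is a claim about the Yang–Mills mass gap

PDF held: `paper:balaban1988-cmp119-convergent-renormalization` (journal page = PDF page + 242); the displays were read on
the x2 renders `…-p026-x2.png` (p. 268) and `…-p027-x2.png` (p. 269) of
`run/shared/lean/pub/pub-balaban/b2b-balaban-ref1/pages/1988-cmp119-convergent-renormalization/`.

CITATION HEADER (lean-in-tree rule).  WHAT IS REPRODUCED, verbatim.
* p. 268 [PDF 26]: *"We want to have characteristic functions depending on the fluctuation field only, hence we
  introduce another decomposition of unity. Consider the domain Ω^{∼−1}_{k+1}, i.e., the domain obtained by taking off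
  one layer of LMR_{k+1}-cubes from Ω_{k+1}. On this domain introduce the decomposition of unity
  1 = Σ_{R_{k+1}} Σ?_{□′⊂Rᶜ_{k+1}} χ({sup_{b∈(□′^{∼2})^{(k)*}} |A_k(b)| < δ_k}) Π_{□′⊂R_{k+1}} χ({sup_{b∈(□′^{∼2})^{(k)*}}
  |A_k(b)| ≧ δ_k}) = Σ_{R_{k+1}} χ^{(k)}(Rᶜ_{k+1}) χ^{(k)c}(R_{k+1}), (3.16) where the summation is over the subdomains
  of Ω^{∼−1}_{k+1}, which are unions of L²M₂R_{k+1}-cubes of the partition of unity, and the complement Rᶜ_{k+1} means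
  the complement of R_{k+1} to the domain Ω^{∼−1}_{k+1}."* (the second `Σ` over `□′ ⊂ Rᶜ_{k+1}` is printed as a sum
  sign but, as in (1.1) p. 246 and by the right-hand side `χ^{(k)}(Rᶜ_{k+1})`, denotes the PRODUCT over those cubes —
  typed as the product; transcript note T15 of ROWS-B14 v1.4) — SKELETON row **B14.Eq3.16**.
* p. 269 [PDF 27]: *"On the domain Ω_{k+1}∩Λᶜ_{k+1} there is the function
  χ(Ω_{k+1}∩Λᶜ_{k+1}, S_{k+1}) = χ^{(k)}(Rᶜ_{k+1}∩Λᶜ_{k+1}) χ^{(k)c}(R_{k+1}) χ′_k(S_{k+1}). (3.21)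
  The last function above depends nonlocally on V_{k+1}, through the function V^{(k)}."* — row **B14.Eq3.21**.
* p. 269 [PDF 27]: *"We want to replace V^{(k)} by the k-th average of the above function. … Denoting
  V^{(k)}(V^{(k)}_{Λᶜ_{k+1}∩Λ_k})⁻¹ = exp i𝐇^{(k)}, (3.22) we obtain that 𝐇^{(k)} is an analytic function of the
  background field U_{k+1} restricted to Λᶜ_{k+1}∩Λ_k, bounded on the set S_{k+1} by O(1)ε_k exp(−R_k), hence by any
  positive power of g_k. Now we make a change of variables for each bond variable A_k(b), b ∈ S^{(k)*}_{k+1}. For bonds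
  in (R^{∼2}_{k+1}∩S_{k+1})^{(k)*} we take the change of variables given by the formula (1.22), with 𝐇^{(k)}(b) instead
  of 𝐇_{1,Ax}(b)."* — row **B14.Eq3.22** (the change of variables itself is `…B14.ChangeOfVariables.newVar`, row
  B14.Eq1.22, fed with `H := bH …` of this file).

THE TYPED READING (one fixed configuration at a time; nothing of the series' geometry is re-declared).
* (3.16): `cubes` = the finite family of L²M₂R_{k+1}-cubes `□′` of `Ω^{∼−1}_{k+1}`; `bonds □′` = the finite bond set
  `(□′^{∼2})^{(k)*}`; the fluctuation field `A : β → 𝔸` (values in a normed group, `|·| = ‖·‖`); `δ = δ_k`.  The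
  small-field condition of a cube is `SmallFluct bonds A δ □′ : ∀ b ∈ bonds □′, ‖A b‖ < δ` (= `sup < δ`; for an EMPTY
  bond set the printed `sup` is ill-defined and the typed condition holds vacuously — the cell's convention, as in
  `B14Sect1Sets.decompUnity`); `chiK` / `chiKc` are the printed products of `0/1` characteristic functions over the
  cubes of a union `X`; a subdomain `R_{k+1}` is a sub-family `R ⊆ cubes` and `Rᶜ_{k+1} = cubes ∖ R`.
* (3.21): the three factors are functions of one configuration type `Φ` (all integration variables); the first two
  are `chiK`/`chiKc` read through the fluctuation-field component `fluct : Φ → β → 𝔸`, the third, `χ′_k(S_{k+1})`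
  (the functions of (3.3) localized in `S_{k+1}`, depending on `V′_k`, `V^{(k)}`), is an arbitrary given family
  `chi' : Finset ι → Φ → ℝ` — (3.21) DEFINES the left-hand side as the product, and that is what is typed.
* (3.22): bondwise, in a complete normed `ℂ`-algebra `𝔸` (the setting of `MatrixLog`, `B14.ChangeOfVariables`):
  for units `V = V^{(k)}(b)`, `W = V^{(k)}_{Λᶜ_{k+1}∩Λ_k}(b)`, `bH V W := (1/i) log(V W⁻¹)` with `log = MatrixLog.mlog`
  (the series (21) of [Balaban1985Averaging]); PROVED: `exp(i·bH V W) = V W⁻¹` whenever `‖V W⁻¹ − 1‖ < 1`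
  (`exp_I_smul_bH`), and the size transfer `‖bH V W‖ ≤ 2‖V W⁻¹ − 1‖` on `‖V W⁻¹ − 1‖ ≤ ½` (`norm_bH_le`) — the
  direction in which "V^{(k)}(V^{(k)}_…)⁻¹ − 1 small" (p. 268, before (3.17)) makes 𝐇^{(k)} small.

WHAT IS PROVED: `eq316` (the decomposition of unity (3.16), by `Π_{□′}(χ_{□′} + χᶜ_{□′}) = 1` expanded,
`Finset.prod_add` — the same mechanism as `B14Sect1Sets.decompUnity` for (1.1)/(1.4)/(1.8), here with the printed
small-field predicate on bond variables), `eq316_term_eq_one_iff` (the single non-zero term: `R` = the family of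
large-field cubes), `chiK_union` (multiplicativity over disjoint unions, the bookkeeping behind *"their product is
χ^{(k)}(Λ_{k+1})"*, p. 269), `exp_I_smul_bH`, `norm_bH_le`.  WHAT IS NOT TYPED OR ASSERTED: the analyticity of 𝐇^{(k)}
in `U_{k+1}` and the bound `O(1)ε_k exp(−R_k)` on `S_{k+1}` (claims by reference to [Balaban1985Variational] (190),
row B11.Eq190, and to (3.17)–(3.19)), the determining set `𝐁(Λᶜ_{k+1}∩Λ_k)∪𝐁_{k+1}` and the function
`U_{k+1,Λᶜ_{k+1}∩Λ_k}(V)` (row B14.Eq2.14, B11 Thm 1), the new action part `V^{(k)}(S_{k+1}, A_k, 𝐇^{(k)})`.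
Mega-formalization `lit-balaban`, unit `lit-balaban-r11` gen 2 (Phase-1 typing of absent rows, lead ruling G.5-9),
HOME `run/shared/lean/pub/lit-balaban/`.

## References
* [Balaban1988Convergent] T. Bałaban, Commun. Math. Phys. 119 (1988) 243–285, (3.16) p. 268, (3.21)–(3.22) p. 269.
* [Balaban1985Averaging] T. Bałaban, Commun. Math. Phys. 98 (1985) 17–51, (21) p. 21 (the logarithm `MatrixLog.mlog`).
-/

namespace Literature.MathematicalPhysics.QuantumFieldTheory.Balaban1983to89.B14.Eq316

open Literature.MathematicalPhysics.QuantumFieldTheory.Balaban1983to89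
open scoped BigOperators

/-! ## §1. (3.16): the fluctuation-field decomposition of unity -/

section Decomposition

variable {ι β 𝔸 : Type*} [SeminormedAddCommGroup 𝔸]

/-- The small-field condition of (3.16) p. 268 for one cube `□′`: `sup_{b∈(□′^{∼2})^{(k)*}} |A_k(b)| < δ_k`, typed as
`∀ b ∈ bonds □′, ‖A b‖ < δ` (`bonds □′` = the finite bond set `(□′^{∼2})^{(k)*}`). [cite: Balaban1988Convergent, (3.16) p.268] -/
def SmallFluct (bonds : ι → Finset β) (A : β → 𝔸) (δ : ℝ) (c : ι) : Prop :=
  ∀ b ∈ bonds c, ‖A b‖ < δ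

/-- Decidability of the small-field condition (classical, through `Real.decidableLT`), so that the `0/1` characteristic
functions below can be written with `if … then … else`. [folklore] -/
noncomputable instance (bonds : ι → Finset β) (A : β → 𝔸) (δ : ℝ) (c : ι) :
    Decidable (SmallFluct bonds A δ c) := by
  unfold SmallFluct; infer_instance

/-- `χ^{(k)}(X) = Π_{□′⊂X} χ({sup_{b∈(□′^{∼2})^{(k)*}} |A_k(b)| < δ_k})` of (3.16) p. 268 — the small fluctuation-field
characteristic function of a union `X` of cubes (value `0` or `1`). [cite: Balaban1988Convergent, (3.16) p.268] -/
noncomputable def chiK (bonds : ι → Finset β) (A : β → 𝔸) (δ : ℝ) (X : Finset ι) : ℝ :=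
  ∏ c ∈ X, if SmallFluct bonds A δ c then (1 : ℝ) else 0

/-- `χ^{(k)c}(X) = Π_{□′⊂X} χ({sup_{b∈(□′^{∼2})^{(k)*}} |A_k(b)| ≧ δ_k})` of (3.16) p. 268 — the large fluctuation-field
characteristic function of a union `X` of cubes. [cite: Balaban1988Convergent, (3.16) p.268] -/
noncomputable def chiKc (bonds : ι → Finset β) (A : β → 𝔸) (δ : ℝ) (X : Finset ι) : ℝ :=
  ∏ c ∈ X, if SmallFluct bonds A δ c then (0 : ℝ) else 1

variable (bonds : ι → Finset β) (A : β → 𝔸) (δ : ℝ)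

/-- The printed `χ({sup … ≧ δ_k})` IS the complement of the small-field condition when the bond set is non-empty:
`¬ SmallFluct ↔ ∃ b ∈ bonds □′, δ ≤ ‖A b‖`. [cite: Balaban1988Convergent, (3.16) p.268] -/
theorem not_smallFluct_iff (c : ι) : ¬ SmallFluct bonds A δ c ↔ ∃ b ∈ bonds c, δ ≤ ‖A b‖ := by
  simp [SmallFluct]

/-- `χ^{(k)}(∅) = 1`. [cite: Balaban1988Convergent, (3.16) p.268] -/
@[simp] theorem chiK_empty : chiK bonds A δ ∅ = 1 := by simp [chiK]

/-- `χ^{(k)c}(∅) = 1`. [cite: Balaban1988Convergent, (3.16) p.268] -/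
@[simp] theorem chiKc_empty : chiKc bonds A δ ∅ = 1 := by simp [chiKc]

/-- Multiplicativity over disjoint unions, `χ^{(k)}(X ∪ Y) = χ^{(k)}(X) χ^{(k)}(Y)` — the bookkeeping behind p. 269
*"On the domain Λ_{k+1} … there are only the small field characteristic functions from (3.16) in the integral, their
product is χ^{(k)}(Λ_{k+1})"*. [cite: Balaban1988Convergent, (3.16) p.268, p.269] -/
theorem chiK_union [DecidableEq ι] {X Y : Finset ι} (h : Disjoint X Y) :
    chiK bonds A δ (X ∪ Y) = chiK bonds A δ X * chiK bonds A δ Y := by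
  unfold chiK; exact Finset.prod_union h

/-- `χ^{(k)c}(X ∪ Y) = χ^{(k)c}(X) χ^{(k)c}(Y)` for disjoint `X`, `Y`. [cite: Balaban1988Convergent, (3.16) p.268] -/
theorem chiKc_union [DecidableEq ι] {X Y : Finset ι} (h : Disjoint X Y) :
    chiKc bonds A δ (X ∪ Y) = chiKc bonds A δ X * chiKc bonds A δ Y := by
  unfold chiKc; exact Finset.prod_union h

/-- `χ^{(k)}(X) = 1` iff every cube of `X` is a small-field cube, and `= 0` otherwise (it is a `0/1` function).
[cite: Balaban1988Convergent, (3.16) p.268] -/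
theorem chiK_eq_one_iff (X : Finset ι) : chiK bonds A δ X = 1 ↔ ∀ c ∈ X, SmallFluct bonds A δ c := by
  unfold chiK
  constructor
  · intro h c hc
    by_contra hn
    have : (∏ c ∈ X, if SmallFluct bonds A δ c then (1 : ℝ) else 0) = 0 :=
      Finset.prod_eq_zero hc (by simp [hn])
    rw [this] at h; exact zero_ne_one h
  · intro h
    exact Finset.prod_eq_one fun c hc => by simp [h c hc]

/-- **(3.16)** p. 268 [PDF 26] — the decomposition of unity on `Ω^{∼−1}_{k+1}`:
`1 = Σ_{R_{k+1}} χ^{(k)}(Rᶜ_{k+1}) χ^{(k)c}(R_{k+1})`, the sum over all sub-families `R ⊆ cubes` of the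
L²M₂R_{k+1}-cubes (`Rᶜ_{k+1} = cubes ∖ R`, "the complement … to the domain Ω^{∼−1}_{k+1}").  PROVED:
`Π_{□′}(χ_{□′} + χᶜ_{□′}) = 1` expanded by `Finset.prod_add`. [cite: Balaban1988Convergent, (3.16) p.268] -/
theorem eq316 [DecidableEq ι] (cubes : Finset ι) :
    ∑ R ∈ cubes.powerset, chiK bonds A δ (cubes \ R) * chiKc bonds A δ R = 1 := by
  unfold chiK chiKc
  set f : ι → ℝ := fun c => if SmallFluct bonds A δ c then (0 : ℝ) else 1 with hf
  set g : ι → ℝ := fun c => if SmallFluct bonds A δ c then (1 : ℝ) else 0 with hg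
  have h1 : ∏ c ∈ cubes, (f c + g c) = 1 := by
    refine Finset.prod_eq_one fun c _ => ?_
    by_cases hc : SmallFluct bonds A δ c <;> simp [hf, hg, hc]
  calc ∑ R ∈ cubes.powerset, (∏ c ∈ cubes \ R, g c) * (∏ c ∈ R, f c)
      = ∑ R ∈ cubes.powerset, (∏ c ∈ R, f c) * (∏ c ∈ cubes \ R, g c) :=
        Finset.sum_congr rfl fun R _ => mul_comm _ _
    _ = ∏ c ∈ cubes, (f c + g c) := (Finset.prod_add f g cubes).symm
    _ = 1 := h1

/-- In (3.16) exactly one term is non-zero at a given configuration: the one with `R_{k+1}` = the family of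
large-field cubes `{□′ : ¬ sup |A_k| < δ_k}` (so the "sum over R_{k+1}" selects THE large fluctuation-field region).
[cite: Balaban1988Convergent, (3.16) p.268] -/
theorem eq316_term_eq_one_iff [DecidableEq ι] (cubes R : Finset ι) (hR : R ⊆ cubes) :
    chiK bonds A δ (cubes \ R) * chiKc bonds A δ R = 1 ↔ R = cubes.filter fun c => ¬ SmallFluct bonds A δ c := by
  have h01K : ∀ X : Finset ι, chiK bonds A δ X = 0 ∨ chiK bonds A δ X = 1 := by
    intro X
    by_cases h : ∀ c ∈ X, SmallFluct bonds A δ c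
    · exact Or.inr ((chiK_eq_one_iff bonds A δ X).2 h)
    · left
      push Not at h
      obtain ⟨c, hc, hn⟩ := h
      exact Finset.prod_eq_zero hc (by simp [hn])
  have hKc1 : ∀ X : Finset ι, chiKc bonds A δ X = 1 ↔ ∀ c ∈ X, ¬ SmallFluct bonds A δ c := by
    intro X
    unfold chiKc
    constructor
    · intro h c hc hs
      have : (∏ c ∈ X, if SmallFluct bonds A δ c then (0 : ℝ) else 1) = 0 :=
        Finset.prod_eq_zero hc (by simp [hs])
      rw [this] at h; exact zero_ne_one h
    · intro h
      exact Finset.prod_eq_one fun c hc => by simp [h c hc]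
  have hKc0 : ∀ X : Finset ι, chiKc bonds A δ X = 0 ∨ chiKc bonds A δ X = 1 := by
    intro X
    by_cases h : ∀ c ∈ X, ¬ SmallFluct bonds A δ c
    · exact Or.inr ((hKc1 X).2 h)
    · left
      push Not at h
      obtain ⟨c, hc, hs⟩ := h
      exact Finset.prod_eq_zero hc (by simp [hs])
  constructor
  · intro h
    have hK : chiK bonds A δ (cubes \ R) = 1 := by
      rcases h01K (cubes \ R) with h0 | h1
      · rw [h0, zero_mul] at h; exact absurd h zero_ne_one
      · exact h1
    have hKc : chiKc bonds A δ R = 1 := by rwa [hK, one_mul] at h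
    rw [chiK_eq_one_iff] at hK
    rw [hKc1] at hKc
    ext c
    simp only [Finset.mem_filter]
    constructor
    · intro hc; exact ⟨hR hc, hKc c hc⟩
    · rintro ⟨hc, hn⟩
      by_contra hcR
      exact hn (hK c (Finset.mem_sdiff.2 ⟨hc, hcR⟩))
  · intro h
    have hK : chiK bonds A δ (cubes \ R) = 1 := by
      rw [chiK_eq_one_iff]
      intro c hc
      rw [Finset.mem_sdiff, h, Finset.mem_filter] at hc
      by_contra hn
      exact hc.2 ⟨hc.1, hn⟩
    have hKc : chiKc bonds A δ R = 1 := by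
      rw [hKc1]
      intro c hc
      rw [h, Finset.mem_filter] at hc
      exact hc.2
    rw [hK, hKc, one_mul]

end Decomposition

/-! ## §2. (3.21): the combined characteristic function on `Ω_{k+1}∩Λᶜ_{k+1}` -/

section Chi321

variable {ι β 𝔸 Φ : Type*} [SeminormedAddCommGroup 𝔸]

/-- **(3.21)** p. 269 [PDF 27], verbatim: *"On the domain Ω_{k+1}∩Λᶜ_{k+1} there is the function
χ(Ω_{k+1}∩Λᶜ_{k+1}, S_{k+1}) = χ^{(k)}(Rᶜ_{k+1}∩Λᶜ_{k+1}) χ^{(k)c}(R_{k+1}) χ′_k(S_{k+1}). (3.21)"* — DEFINED as the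
printed product: the (3.16)-functions `chiK`/`chiKc` of the fluctuation-field component `fluct φ` of the configuration
on the cube families `RcΛc = Rᶜ_{k+1}∩Λᶜ_{k+1}` and `R = R_{k+1}`, times the given family `chi' S` = `χ′_k(S_{k+1})`
(the (3.3)-functions localized in `S_{k+1}`; it "depends nonlocally on V_{k+1}, through the function V^{(k)}").
[cite: Balaban1988Convergent, (3.21) p.269] -/
noncomputable def chi321 (bonds : ι → Finset β) (δ : ℝ) (fluct : Φ → β → 𝔸) (chi' : Finset ι → Φ → ℝ)
    (RcΛc R S : Finset ι) (φ : Φ) : ℝ :=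
  chiK bonds (fluct φ) δ RcΛc * chiKc bonds (fluct φ) δ R * chi' S φ

/-- (3.21) is a `0/1`-weighted version of `χ′_k(S_{k+1})`: it equals `χ′_k(S_{k+1})(φ)` when every cube of
`Rᶜ_{k+1}∩Λᶜ_{k+1}` is a small-field cube and every cube of `R_{k+1}` a large-field cube of `φ`, and `0` otherwise.
[cite: Balaban1988Convergent, (3.21) p.269] -/
theorem chi321_eq_of_small_large (bonds : ι → Finset β) (δ : ℝ) (fluct : Φ → β → 𝔸) (chi' : Finset ι → Φ → ℝ)
    (RcΛc R S : Finset ι) (φ : Φ) (hsmall : ∀ c ∈ RcΛc, SmallFluct bonds (fluct φ) δ c)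
    (hlarge : ∀ c ∈ R, ¬ SmallFluct bonds (fluct φ) δ c) :
    chi321 bonds δ fluct chi' RcΛc R S φ = chi' S φ := by
  unfold chi321
  rw [(chiK_eq_one_iff bonds (fluct φ) δ RcΛc).2 hsmall, one_mul]
  have : chiKc bonds (fluct φ) δ R = 1 := Finset.prod_eq_one fun c hc => by simp [hlarge c hc]
  rw [this, one_mul]

end Chi321

/-! ## §3. (3.22): the function 𝐇^{(k)} -/

section H322

open NormedSpace MatrixLog

variable {𝔸 : Type*} [NormedRing 𝔸] [NormedAlgebra ℂ 𝔸]

/-- **(3.22)** p. 269 [PDF 27], verbatim: *"Denoting V^{(k)}(V^{(k)}_{Λᶜ_{k+1}∩Λ_k})⁻¹ = exp i𝐇^{(k)}, (3.22)"* —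
bondwise, for the unit `V = V^{(k)}(b)` and the unit `W = V^{(k)}_{Λᶜ_{k+1}∩Λ_k}(b)` of a complete normed `ℂ`-algebra
`𝔸 ⊇ G`: `𝐇^{(k)}(b) := (1/i) log(V W⁻¹)`, `log` = the series `MatrixLog.mlog` ((21) of [Balaban1985Averaging]),
defined near `V W⁻¹ = 1`. [cite: Balaban1988Convergent, (3.22) p.269] -/
noncomputable def bH (V W : 𝔸ˣ) : 𝔸 :=
  (Complex.I : ℂ)⁻¹ • mlog ((V * W⁻¹ : 𝔸ˣ) : 𝔸)

/-- `i · 𝐇^{(k)} = log(V W⁻¹)`. [cite: Balaban1988Convergent, (3.22) p.269] -/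
theorem I_smul_bH (V W : 𝔸ˣ) : (Complex.I : ℂ) • bH V W = mlog ((V * W⁻¹ : 𝔸ˣ) : 𝔸) := by
  unfold bH
  rw [smul_smul, mul_inv_cancel₀ Complex.I_ne_zero, one_smul]

variable [CompleteSpace 𝔸]

/-- **(3.22) holds for the typed 𝐇^{(k)}**: `exp(i𝐇^{(k)}) = V^{(k)}(V^{(k)}_{Λᶜ_{k+1}∩Λ_k})⁻¹` whenever
`|V^{(k)}(V^{(k)}_…)⁻¹ − 1| < 1` (the convergence disc of the logarithm (21); p. 268: *"the configuration
V^{(k)}(V^{(k)}_{□′})⁻¹ − 1 is small, much smaller than δ_k"*). [cite: Balaban1988Convergent, (3.22) p.269] -/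
theorem exp_I_smul_bH (V W : 𝔸ˣ) (h : ‖((V * W⁻¹ : 𝔸ˣ) : 𝔸) - 1‖ < 1) :
    exp ((Complex.I : ℂ) • bH V W) = ((V * W⁻¹ : 𝔸ˣ) : 𝔸) := by
  rw [I_smul_bH, exp_mlog h]

/-- Size transfer for (3.22): `‖𝐇^{(k)}‖ ≤ 2‖V W⁻¹ − 1‖` on `‖V W⁻¹ − 1‖ ≤ ½` (`MatrixLog.norm_mlog_le_two_mul`) — the
mechanism by which the smallness of `V^{(k)}(V^{(k)}_…)⁻¹ − 1` ((3.19) p. 268) bounds 𝐇^{(k)}; the printed bound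
`O(1)ε_k exp(−R_k)` on `S_{k+1}` itself is NOT asserted here. [cite: Balaban1988Convergent, (3.22) p.269] -/
theorem norm_bH_le (V W : 𝔸ˣ) (h : ‖((V * W⁻¹ : 𝔸ˣ) : 𝔸) - 1‖ ≤ 1 / 2) :
    ‖bH V W‖ ≤ 2 * ‖((V * W⁻¹ : 𝔸ˣ) : 𝔸) - 1‖ := by
  have hI : ‖bH V W‖ = ‖(Complex.I : ℂ) • bH V W‖ := by
    rw [norm_smul, Complex.norm_I, one_mul]
  rw [hI, I_smul_bH]
  exact norm_mlog_le_two_mul h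

omit [CompleteSpace 𝔸] in
/-- When the two configurations agree on the bond, `𝐇^{(k)}(b) = 0`. [cite: Balaban1988Convergent, (3.22) p.269] -/
theorem bH_self (V : 𝔸ˣ) : bH V V = 0 := by
  unfold bH
  simp

end H322

end Literature.MathematicalPhysics.QuantumFieldTheory.Balaban1983to89.B14.Eq316
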